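import Mathlib
import HarnessLib

/-!
# Barrier: the axis-profile facts of the critical two-point function do not give all-scale doubling

Barrier catalogue `Literature/Barriers/CriticalPhenomena/` (D-0021), entry for the sub-problem
`CriticalPhenomena/Ising3DConformalLimit`, item `TwoPointDoubling` (stmt-CriticalPhenomena-6150:
`∃ κ > 0, ∀ n ≥ 1, κ·g(n) ≤ g(2n)` for `g(n) = ⟨σ₀σ_{n e₀}⟩⁺_{β_c(3)}`, the nearest-neighbour Ising model
on `ℤ³`), through which every compactness route to the existence of the critical scaling limit passes
(`…Cruxes.ExistsScaleCovariantLimit.Funnel.all_fail_of_not_twoPointDoubling`).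

What the sources print. All-scale regularity of the critical two-point function on `ℤ³` (and `ℤ⁴`) is
OPEN: Aizenman–Duminil-Copin, Ann. of Math. 194 (2021) = arXiv:1912.07973, Remark 5.10 ("It would be
of interest to remove the `log n` factor, as this would enable a proof that `S(ne₁)` does not drop too
fast between different scales") and §5.6 (Def. 5.11, Thm 5.12: regular scales have positive density;
"for now we do not have an unconditional proof" that every scale is regular). What IS proved about the
axis profile `g` — and formalised in the tree — is: `g(0) = 1`, `g > 0`; `g` is non-increasing
(Messager–Miracle-Solé); the one-step ratios `g(k+2)/g(k+1)` are non-decreasing (reflection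
positivity / transfer-matrix log-convexity, `criticalTwoPoint_axis_ratio_mono`; in full strength the
Källén–Lehmann representation `g(n) = ∫ e^{-an} dμ(a)`, ADC21 Prop. 8.6 = tree named fact
`AizenmanDuminilCopin2021_prop_8_6`); the envelopes `c/n² ≤ g(n) ≤ C/n` (Simon–Lieb lower bound,
infrared bound + MMS; tree `axis_sq_level_ge`, `axis_level_le`); the sliding-scale infrared bound
`χ_L/L² ≤ K χ_ℓ/ℓ²` (ADC21 Thm 5.6, tree `aizenmanDuminilCopin_slidingScaleInfraredBound_holds`), which on
the profile reads `P(L)/L² ≤ K·P(ℓ)/ℓ²` for `P(n) = Σ_{k≤n} k² g(k)` (MMS sandwich); and the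
Duminil-Copin–Panis lower bound (CMP 406 (2025) = arXiv:2404.05700, Thm 1.3, tree
`dcp_criticalTwoPoint_axis_lower_holds`), which on the profile reads
`c₁ ≤ g(n)·(1 + Σ_{k≤4n} k² g(k) + n Σ_{k≤2n} k g(k))`.

What is proved here (no `sorry`, no named fact, no new axiom).
* `AxisDoubling g`, `AxisProfileFacts g`, `HasAxisSpectralRepresentation g` — the conclusion, the
  profile facts above, and the Källén–Lehmann shape, as predicates on an abstract profile `g : ℕ → ℝ`;
  `AxisProfileDoublingFor g := AxisProfileFacts g → HasAxisSpectralRepresentation g → AxisDoubling g`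
  is the TECHNIQUE CLASS "prove doubling from the axis-profile facts".
* `ratio_mono_of_hasAxisSpectralRepresentation` — the spectral shape implies log-convexity
  (Cauchy–Schwarz), `sliding_of_level_antitone` — `k·g(k)` non-increasing gives the profile sliding-scale
  bound with `K = 3`, `dcp_of_lower_threeHalves` — `g(n) ≥ c n^{-3/2}` ALONE gives the DCP profile
  bound (Theorem 1.3 is void above the `η = 1/2` line).
* THE WITNESS `AxisProfileNoDoubling.g`: `g(n) = (nZ)⁻¹ Σ_i 2^{-i²} (e^{-n/M_i} − e^{-3n})`,
  `M_i = 2^{4i²}`, `Z = Σ_i 2^{-i²}(3 − 2^{-4i²})` — a lacunary mixture of "massive episodes": it has the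
  spectral representation with the probability measure `Z⁻¹ Σ_i 2^{-i²}·Leb|[2^{-4i²}, 3]`
  (`hasAxisSpectralRepresentation_g`), satisfies every field of `AxisProfileFacts`
  (`axisProfileFacts_g`), and MORE: `k·g(k)` is non-increasing (`level_antitone_g`) and
  `g(n) ≥ n^{-3/2}/96` at EVERY scale (`lower_threeHalves_g`: every scale is "fat" in the sense of the
  birth line of item 6150), yet `g(2nᵢ) ≤ 4(e/4)^i g(nᵢ)` at `nᵢ = i·2^{4i²}` (`not_axisDoubling_g`).
* `exists_axisProfileFacts_not_axisDoubling`, `not_forall_axisProfileDoublingFor` — the master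
  statement of the class is FALSE.

technique_class: axis-profile axiomatics — any argument for all-scale doubling of the critical
two-point function that uses only the listed facts about the axis sequence `n ↦ ⟨σ₀σ_{ne₀}⟩_{β_c}`
(positivity, normalisation, MMS monotonicity, RP log-convexity or the full Källén–Lehmann
representation, the two envelopes — even the DCP-fat lower envelope `n^{-3/2}` —, the sliding-scale
infrared bound and the Duminil-Copin–Panis Theorem 1.3 in profile form).
blocks: `Summit.CriticalPhenomena.Ising3DConformalLimit.Theses.MirrorHoelderCompactness.TwoPointDoubling`
(item 6150) and, through the funnel, `OrbitPrecompact` (5955), `UniformRegularity` (4658),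
`PointwiseLimit` (6153), `ZoomMonotone` (14454) and the crux `ExistsScaleCovariantLimit` (1981) insofar
as a route would derive them from the profile facts; in particular the fat-regime stub
`stub_fatScaleDoubling` of the birth line of 6150 cannot be closed by these facts (the witness is fat at
every scale).
because: the listed facts are all satisfied by lacunary mixtures of exponentials (this file); on paper
the same holds for the restriction to `ℤ³` of the generalised free field `Σ_i √w_i Φ_{M_i}` (Euclidean
invariant, OS-positive in every hyperplane, MMS-monotone), so adding rotations / RP in all lattice
mirrors at the two-point level does not help either (crux 1981 census s1 §N1, not formalised here).
[cite: AizenmanDuminilCopinAnnals2021, arXiv:1912.07973 Remark 5.10 and §5.6]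
evasions_known: inputs that see the finite-range Gibbs / random-current structure rather than the
two-point function — Aizenman's folded-current identity `1 − g(k+2)/g(k) = P[wall avoidance]`
(arXiv:2509.02850 Thm 14.2; tree `…FoldedCurrentRepulsion.stub_foldedIdentity`) with a repulsion
estimate, the switching lemma beyond Simon–Lieb, IIC ratio mixing (Panis, arXiv:2406.15243); none
proved to give doubling. [cite: DuminilCopinPanis2025LowerBounds, Theorem 1.3 and Theorem 1.5]
status: proved (this file); the Ising instance `AxisProfileFacts (fun n => criticalTwoPoint 3 (Pi.single 0 n))`
is assembled summit-side from the tree theorems named above (registered sub-goals `axis_dcp_profile`,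
`axis_sliding_profile` of item stmt-CriticalPhenomena-1981).

## References

* M. Aizenman, H. Duminil-Copin, Ann. of Math. 194 (2021), arXiv:1912.07973, Prop. 5.9, Remark 5.10,
  §5.6 (Def. 5.11, Thm 5.12), Thm 5.6, Prop. 8.6 [AizenmanDuminilCopinAnnals2021].
* H. Duminil-Copin, R. Panis, Comm. Math. Phys. 406 (2025), arXiv:2404.05700, Thms 1.3, 1.5
  [DuminilCopinPanis2025LowerBounds].
* A. Messager, S. Miracle-Solé, J. Stat. Phys. 17 (1977) [MessagerMiracleSoleJSP1977].
-/

noncomputable section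

open MeasureTheory Set Filter Finset Real
open scoped BigOperators Topology ENNReal

namespace Literature.Barriers.CriticalPhenomena

/-! ## §1 The technique class -/

/-- **All-scale doubling of an axis profile** `g : ℕ → ℝ`: `∃ κ > 0, ∀ n ≥ 1, κ g(n) ≤ g(2n)` — the shape
of item `TwoPointDoubling` (stmt-CriticalPhenomena-6150) with `g n = criticalTwoPoint 3 (Pi.single 0 n)`.
[cite: AizenmanDuminilCopinAnnals2021, arXiv:1912.07973 Remark 5.10] -/
def AxisDoubling (g : ℕ → ℝ) : Prop :=
  ∃ κ : ℝ, 0 < κ ∧ ∀ n : ℕ, 1 ≤ n → κ * g n ≤ g (2 * n)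

/-- **The axis-profile facts** of the critical two-point function `g(n) = ⟨σ₀σ_{ne₀}⟩_{β_c}` on `ℤ³`, as
a predicate on an abstract profile: normalisation and positivity; MMS monotonicity; RP log-convexity
(`g(k+2)/g(k+1)` non-decreasing — tree `criticalTwoPoint_axis_ratio_mono`); the level envelope
`n g(n) ≤ C` (infrared bound + MMS — tree `axis_level_le`) and the Simon–Lieb envelope `c ≤ n² g(n)`
(tree `axis_sq_level_ge`); the sliding-scale infrared bound in profile form
`P(L)/L² ≤ K P(ℓ)/ℓ²`, `P(n) = Σ_{k=1}^{n} k² g(k)` (ADC21 Thm 5.6 + MMS sandwich); the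
Duminil-Copin–Panis Theorem 1.3 in profile form `c₁ ≤ g(n)(1 + Σ_{k≤4n} k² g(k) + n Σ_{k≤2n} k g(k))`.
[cite: AizenmanDuminilCopinAnnals2021, arXiv:1912.07973 §5 (Prop. 5.9, Thm 5.6)] -/
structure AxisProfileFacts (g : ℕ → ℝ) : Prop where
  /-- `g(0) = ⟨σ₀²⟩ = 1`. -/
  zero : g 0 = 1
  /-- `g > 0` (Griffiths). -/
  pos : ∀ n, 0 < g n
  /-- `g` is non-increasing along the axis (Messager–Miracle-Solé). -/
  antitone : Antitone g
  /-- the one-step ratios are non-decreasing (reflection positivity). -/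
  ratio_mono : Monotone fun k => g (k + 2) / g (k + 1)
  /-- the level envelope `n g(n) ≤ C` (infrared bound). -/
  upper : ∃ C : ℝ, ∀ n : ℕ, 1 ≤ n → (n : ℝ) * g n ≤ C
  /-- the Simon–Lieb envelope `c ≤ n² g(n)`. -/
  lower : ∃ c : ℝ, 0 < c ∧ ∀ n : ℕ, 1 ≤ n → c ≤ (n : ℝ) ^ 2 * g n
  /-- the sliding-scale infrared bound in profile form. -/
  sliding : ∃ K : ℝ, ∀ l L : ℕ, 1 ≤ l → l ≤ L →
    (∑ k ∈ Finset.Icc 1 L, (k : ℝ) ^ 2 * g k) / (L : ℝ) ^ 2 ≤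
      K * ((∑ k ∈ Finset.Icc 1 l, (k : ℝ) ^ 2 * g k) / (l : ℝ) ^ 2)
  /-- the Duminil-Copin–Panis lower bound (Thm 1.3) in profile form. -/
  dcp : ∃ c₁ : ℝ, 0 < c₁ ∧ ∀ n : ℕ, 1 ≤ n →
    c₁ ≤ g n * (1 + ∑ k ∈ Finset.Icc 1 (4 * n), (k : ℝ) ^ 2 * g k +
      (n : ℝ) * ∑ k ∈ Finset.Icc 1 (2 * n), (k : ℝ) * g k)

/-- **The Källén–Lehmann (spectral) shape** of an axis profile: `g(n) = ∫ e^{-an} dμ(a)` for a finite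
positive measure `μ` carried by `[0, ∞)` — the form of Aizenman–Duminil-Copin 2021 Prop. 8.6 (tree named
fact `AizenmanDuminilCopin2021_prop_8_6`, there for `n : ℤ` with `|n|`).
[cite: AizenmanDuminilCopinAnnals2021, Appendix §8.3 Prop. 8.6] -/
def HasAxisSpectralRepresentation (g : ℕ → ℝ) : Prop :=
  ∃ μ : Measure ℝ, IsFiniteMeasure μ ∧ μ (Set.Ici (0 : ℝ))ᶜ = 0 ∧
    ∀ n : ℕ, g n = ∫ a, Real.exp (-(a * n)) ∂μ

/-- **The technique class** "all-scale doubling from the axis-profile facts" at a profile `g`: the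
profile facts together with the full spectral representation imply doubling. Its master statement
`∀ g, AxisProfileDoublingFor g` is refuted below (`not_forall_axisProfileDoublingFor`).
[cite: AizenmanDuminilCopinAnnals2021, arXiv:1912.07973 Remark 5.10] -/
def AxisProfileDoublingFor (g : ℕ → ℝ) : Prop :=
  AxisProfileFacts g → HasAxisSpectralRepresentation g → AxisDoubling g

/-! ## §2 General lemmas on profiles -/

/-- Under the spectral shape the profile is log-convex: `g(k+2)² ≤ g(k+1) g(k+3)` (Cauchy–Schwarz in
`L²(μ)` with `e^{-a(k+2)} = e^{-a(k+1)/2} e^{-a(k+3)/2}`). [folklore] -/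
theorem sq_le_mul_of_hasAxisSpectralRepresentation {g : ℕ → ℝ}
    (hsp : HasAxisSpectralRepresentation g) (k : ℕ) :
    g (k + 2) ^ 2 ≤ g (k + 1) * g (k + 3) := by
  obtain ⟨μ, hfin, hsupp, hg⟩ := hsp
  haveI := hfin
  -- a.e. `a ≥ 0`
  have hae : ∀ᵐ a ∂μ, 0 ≤ a := by
    have : ∀ᵐ a ∂μ, a ∉ (Set.Ici (0 : ℝ))ᶜ := measure_eq_zero_iff_ae_notMem.1 hsupp
    filter_upwards [this] with a ha
    simpa using ha
  set F : ℝ → ℝ := fun a => Real.exp (-(a * (k + 1 : ℕ)) / 2) with hF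
  set G : ℝ → ℝ := fun a => Real.exp (-(a * (k + 3 : ℕ)) / 2) with hG
  have hFm : AEStronglyMeasurable F μ := by
    have : Continuous F := by
      simp only [hF]; fun_prop
    exact this.aestronglyMeasurable
  have hGm : AEStronglyMeasurable G μ := by
    have : Continuous G := by
      simp only [hG]; fun_prop
    exact this.aestronglyMeasurable
  have hFb : ∀ᵐ a ∂μ, ‖F a‖ ≤ 1 := by
    filter_upwards [hae] with a ha
    simp only [hF, Real.norm_eq_abs, abs_of_pos (Real.exp_pos _)]
    apply Real.exp_le_one_iff.2
    have : (0 : ℝ) ≤ a * (k + 1 : ℕ) := by positivity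
    linarith
  have hGb : ∀ᵐ a ∂μ, ‖G a‖ ≤ 1 := by
    filter_upwards [hae] with a ha
    simp only [hG, Real.norm_eq_abs, abs_of_pos (Real.exp_pos _)]
    apply Real.exp_le_one_iff.2
    have : (0 : ℝ) ≤ a * (k + 3 : ℕ) := by positivity
    linarith
  have hFp : MemLp F (ENNReal.ofReal 2) μ := MemLp.of_bound hFm 1 hFb
  have hGp : MemLp G (ENNReal.ofReal 2) μ := MemLp.of_bound hGm 1 hGb
  have hF0 : 0 ≤ᵐ[μ] F := Eventually.of_forall fun a => (Real.exp_pos _).le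
  have hG0 : 0 ≤ᵐ[μ] G := Eventually.of_forall fun a => (Real.exp_pos _).le
  have key := integral_mul_le_Lp_mul_Lq_of_nonneg Real.HolderConjugate.two_two hF0 hG0 hFp hGp
  -- identify the three integrals
  have hFG : (fun a => F a * G a) = fun a => Real.exp (-(a * (k + 2 : ℕ))) := by
    funext a
    simp only [hF, hG, ← Real.exp_add]
    congr 1
    push_cast
    ring
  have hF2 : (fun a => F a ^ (2 : ℝ)) = fun a => Real.exp (-(a * (k + 1 : ℕ))) := by
    funext a
    simp only [hF, Real.rpow_two, sq, ← Real.exp_add]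
    congr 1
    ring
  have hG2 : (fun a => G a ^ (2 : ℝ)) = fun a => Real.exp (-(a * (k + 3 : ℕ))) := by
    funext a
    simp only [hG, Real.rpow_two, sq, ← Real.exp_add]
    congr 1
    ring
  rw [hFG, hF2, hG2, ← hg (k + 2), ← hg (k + 1), ← hg (k + 3)] at key
  have h1 : 0 ≤ g (k + 1) := by
    rw [hg]; exact integral_nonneg fun a => (Real.exp_pos _).le
  have h3 : 0 ≤ g (k + 3) := by
    rw [hg]; exact integral_nonneg fun a => (Real.exp_pos _).le
  have h2 : 0 ≤ g (k + 2) := by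
    rw [hg]; exact integral_nonneg fun a => (Real.exp_pos _).le
  have hs1 : g (k + 1) ^ (1 / (2 : ℝ)) = Real.sqrt (g (k + 1)) := by
    rw [Real.sqrt_eq_rpow, one_div]
  have hs3 : g (k + 3) ^ (1 / (2 : ℝ)) = Real.sqrt (g (k + 3)) := by
    rw [Real.sqrt_eq_rpow, one_div]
  rw [hs1, hs3] at key
  calc g (k + 2) ^ 2 ≤ (Real.sqrt (g (k + 1)) * Real.sqrt (g (k + 3))) ^ 2 :=
        pow_le_pow_left₀ h2 key 2
    _ = g (k + 1) * g (k + 3) := by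
        rw [mul_pow, Real.sq_sqrt h1, Real.sq_sqrt h3]

/-- Under the spectral shape and positivity, the one-step ratios `g(k+2)/g(k+1)` are non-decreasing
(log-convexity). [folklore] -/
theorem ratio_mono_of_hasAxisSpectralRepresentation {g : ℕ → ℝ} (hpos : ∀ n, 0 < g n)
    (hsp : HasAxisSpectralRepresentation g) : Monotone fun k => g (k + 2) / g (k + 1) := by
  refine monotone_nat_of_le_succ fun k => ?_
  have h1 := hpos (k + 1)
  have h2 := hpos (k + 2)
  have key := sq_le_mul_of_hasAxisSpectralRepresentation hsp k
  show g (k + 2) / g (k + 1) ≤ g (k + 1 + 2) / g (k + 1 + 1)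
  rw [show k + 1 + 2 = k + 3 by ring, show k + 1 + 1 = k + 2 by ring, div_le_div_iff₀ h1 h2]
  nlinarith [key]

/-- **Sliding-scale bound from a non-increasing level function.** If `g ≥ 0` and `k ↦ k g(k)` is
non-increasing on `k ≥ 1`, then `P(L)/L² ≤ 3 P(ℓ)/ℓ²` for `1 ≤ ℓ ≤ L`, `P(n) = Σ_{k=1}^{n} k² g(k)`
(the shell `ℓ < k ≤ L` contributes at most `L²·ℓ g(ℓ) ≤ 2 (L/ℓ)² P(ℓ)`). [folklore] -/
theorem sliding_of_level_antitone {g : ℕ → ℝ} (hg0 : ∀ n, 0 ≤ g n)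
    (hlev : ∀ n : ℕ, 1 ≤ n → ((n : ℝ) + 1) * g (n + 1) ≤ n * g n) :
    ∀ l L : ℕ, 1 ≤ l → l ≤ L →
      (∑ k ∈ Finset.Icc 1 L, (k : ℝ) ^ 2 * g k) / (L : ℝ) ^ 2 ≤
        3 * ((∑ k ∈ Finset.Icc 1 l, (k : ℝ) ^ 2 * g k) / (l : ℝ) ^ 2) := by
  intro l L hl hlL
  -- the level function `h k = k g k` is non-increasing on `k ≥ 1`
  have hanti : ∀ a b : ℕ, 1 ≤ a → a ≤ b → (b : ℝ) * g b ≤ a * g a := by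
    intro a b ha hab
    induction b, hab using Nat.le_induction with
    | base => exact le_rfl
    | succ m ham ih =>
        have := hlev m (by omega)
        push_cast at this ⊢
        linarith
  set P : ℕ → ℝ := fun n => ∑ k ∈ Finset.Icc 1 n, (k : ℝ) ^ 2 * g k with hP
  have hl0 : (0 : ℝ) < l := by exact_mod_cast hl
  have hL0 : (0 : ℝ) < L := by exact_mod_cast (hl.trans hlL)
  have hlL' : (l : ℝ) ≤ L := by exact_mod_cast hlL
  -- `P L ≤ P l + L² · (l g l)`
  have hsplit : P L = P l + ∑ k ∈ Finset.Ioc l L, (k : ℝ) ^ 2 * g k := by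
    simp only [hP]
    rw [← Finset.sum_union]
    · congr 1
      ext k
      simp only [Finset.mem_Icc, Finset.mem_union, Finset.mem_Ioc]
      omega
    · rw [Finset.disjoint_left]
      intro k hk hk'
      simp only [Finset.mem_Icc] at hk
      simp only [Finset.mem_Ioc] at hk'
      omega
  have hshell : ∑ k ∈ Finset.Ioc l L, (k : ℝ) ^ 2 * g k ≤ (L : ℝ) ^ 2 * ((l : ℝ) * g l) := by
    calc ∑ k ∈ Finset.Ioc l L, (k : ℝ) ^ 2 * g k
        ≤ ∑ k ∈ Finset.Ioc l L, (L : ℝ) * ((l : ℝ) * g l) := by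
          refine Finset.sum_le_sum fun k hk => ?_
          simp only [Finset.mem_Ioc] at hk
          have hk1 : (k : ℝ) ≤ L := by exact_mod_cast hk.2
          have hk0 : (0 : ℝ) ≤ k := Nat.cast_nonneg k
          have := hanti l k hl hk.1.le
          calc (k : ℝ) ^ 2 * g k = k * (k * g k) := by ring
            _ ≤ L * ((l : ℝ) * g l) :=
              mul_le_mul hk1 this (mul_nonneg hk0 (hg0 k)) hL0.le
      _ = (Finset.Ioc l L).card * ((L : ℝ) * ((l : ℝ) * g l)) := by
          rw [Finset.sum_const, nsmul_eq_mul]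
      _ ≤ (L : ℝ) * ((L : ℝ) * ((l : ℝ) * g l)) := by
          refine mul_le_mul_of_nonneg_right ?_ (mul_nonneg hL0.le (mul_nonneg hl0.le (hg0 l)))
          rw [Nat.card_Ioc]
          exact_mod_cast Nat.sub_le L l
      _ = (L : ℝ) ^ 2 * ((l : ℝ) * g l) := by ring
  -- `l² · (l g l) ≤ 2 P l`
  have hhead : (l : ℝ) ^ 2 * ((l : ℝ) * g l) ≤ 2 * P l := by
    have h1 : ∑ k ∈ Finset.Icc 1 l, (k : ℝ) * ((l : ℝ) * g l) ≤ P l := by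
      simp only [hP]
      refine Finset.sum_le_sum fun k hk => ?_
      simp only [Finset.mem_Icc] at hk
      have := hanti k l hk.1 hk.2
      have hk0 : (0 : ℝ) ≤ k := Nat.cast_nonneg k
      calc (k : ℝ) * ((l : ℝ) * g l) ≤ k * (k * g k) := mul_le_mul_of_nonneg_left this hk0
        _ = (k : ℝ) ^ 2 * g k := by ring
    have h2 : ∑ k ∈ Finset.Icc 1 l, (k : ℝ) * ((l : ℝ) * g l) =
        (∑ k ∈ Finset.Icc 1 l, (k : ℝ)) * ((l : ℝ) * g l) := by rw [Finset.sum_mul]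
    -- Gauss: `l² ≤ 2 Σ_{k=1}^{l} k`
    have h3 : ∀ m : ℕ, (m : ℝ) ^ 2 ≤ 2 * ∑ k ∈ Finset.Icc 1 m, (k : ℝ) := by
      intro m
      induction m with
      | zero => simp
      | succ m ih =>
          rw [Finset.sum_Icc_succ_top (by omega : 1 ≤ m + 1)]
          push_cast
          nlinarith [ih]
    have hlg : 0 ≤ (l : ℝ) * g l := mul_nonneg hl0.le (hg0 l)
    have h4 := h3 l
    calc (l : ℝ) ^ 2 * ((l : ℝ) * g l) ≤ (2 * ∑ k ∈ Finset.Icc 1 l, (k : ℝ)) * ((l : ℝ) * g l) :=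
          mul_le_mul_of_nonneg_right h4 hlg
      _ = 2 * ∑ k ∈ Finset.Icc 1 l, (k : ℝ) * ((l : ℝ) * g l) := by rw [h2]; ring
      _ ≤ 2 * P l := by linarith
  have hPl0 : 0 ≤ P l := by
    simp only [hP]
    exact Finset.sum_nonneg fun k _ => mul_nonneg (sq_nonneg _) (hg0 k)
  -- assemble
  have hPL : P L ≤ P l + (L : ℝ) ^ 2 * ((l : ℝ) * g l) := by rw [hsplit]; linarith
  rw [div_le_iff₀ (by positivity)]
  have hlev' : (L : ℝ) ^ 2 * ((l : ℝ) * g l) ≤ (L : ℝ) ^ 2 * (2 * P l / (l : ℝ) ^ 2) := by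
    refine mul_le_mul_of_nonneg_left ?_ (by positivity)
    rw [le_div_iff₀ (by positivity)]
    linarith
  have hmono : P l ≤ (L : ℝ) ^ 2 * (P l / (l : ℝ) ^ 2) := by
    rw [mul_div_assoc']
    rw [le_div_iff₀ (by positivity)]
    have : (l : ℝ) ^ 2 ≤ (L : ℝ) ^ 2 := pow_le_pow_left₀ hl0.le hlL' 2
    nlinarith
  calc P L ≤ P l + (L : ℝ) ^ 2 * ((l : ℝ) * g l) := hPL
    _ ≤ (L : ℝ) ^ 2 * (P l / (l : ℝ) ^ 2) + (L : ℝ) ^ 2 * (2 * P l / (l : ℝ) ^ 2) :=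
        add_le_add hmono hlev'
    _ = 3 * (P l / (l : ℝ) ^ 2) * (L : ℝ) ^ 2 := by ring

/-- **The DCP profile bound is void above the `η = 1/2` line.** If `g ≥ 0` and `c ≤ n √n g(n)` for all
`n ≥ 1` (`g(n) ≥ c n^{-3/2}`), then `c² ≤ g(n)(1 + Σ_{k≤4n} k² g(k) + n Σ_{k≤2n} k g(k))` for all `n ≥ 1`
(`k g(k) ≥ c/(2√n)` for `k ≤ 2n`, so the last sum is `≥ c √n`). [folklore] -/
theorem dcp_of_lower_threeHalves {g : ℕ → ℝ} (hg0 : ∀ n, 0 ≤ g n) {c : ℝ} (hc : 0 < c)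
    (hlow : ∀ n : ℕ, 1 ≤ n → c ≤ (n : ℝ) * Real.sqrt n * g n) :
    ∀ n : ℕ, 1 ≤ n →
      c ^ 2 ≤ g n * (1 + ∑ k ∈ Finset.Icc 1 (4 * n), (k : ℝ) ^ 2 * g k +
        (n : ℝ) * ∑ k ∈ Finset.Icc 1 (2 * n), (k : ℝ) * g k) := by
  intro n hn
  have hn0 : (0 : ℝ) < n := by exact_mod_cast hn
  have hsq0 : 0 < Real.sqrt n := Real.sqrt_pos.2 hn0
  -- each `k g(k) ≥ c / (2 √n)` for `1 ≤ k ≤ 2n`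
  have hterm : ∀ k ∈ Finset.Icc 1 (2 * n), c / (2 * Real.sqrt n) ≤ (k : ℝ) * g k := by
    intro k hk
    simp only [Finset.mem_Icc] at hk
    have hk0 : (0 : ℝ) < k := by exact_mod_cast hk.1
    have hkle : (k : ℝ) ≤ 2 * n := by exact_mod_cast hk.2
    have hsk : Real.sqrt k ≤ 2 * Real.sqrt n := by
      calc Real.sqrt k ≤ Real.sqrt (4 * n) := Real.sqrt_le_sqrt (by linarith)
        _ = 2 * Real.sqrt n := by
          rw [Real.sqrt_mul (by norm_num), show (4 : ℝ) = 2 ^ 2 by norm_num,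
            Real.sqrt_sq (by norm_num)]
    have hsk0 : 0 < Real.sqrt k := Real.sqrt_pos.2 hk0
    have h1 := hlow k hk.1
    rw [div_le_iff₀ (by positivity)]
    calc c ≤ (k : ℝ) * Real.sqrt k * g k := h1
      _ ≤ (k : ℝ) * (2 * Real.sqrt n) * g k := by
          have : 0 ≤ (k : ℝ) * g k := mul_nonneg hk0.le (hg0 k)
          nlinarith
      _ = (k : ℝ) * g k * (2 * Real.sqrt n) := by ring
  have hsum : (2 * n : ℕ) * (c / (2 * Real.sqrt n)) ≤ ∑ k ∈ Finset.Icc 1 (2 * n), (k : ℝ) * g k := by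
    have := Finset.card_nsmul_le_sum (Finset.Icc 1 (2 * n)) (fun k => (k : ℝ) * g k)
      (c / (2 * Real.sqrt n)) hterm
    rw [Nat.card_Icc, nsmul_eq_mul] at this
    simpa using this
  have hS0 : 0 ≤ ∑ k ∈ Finset.Icc 1 (4 * n), (k : ℝ) ^ 2 * g k :=
    Finset.sum_nonneg fun k _ => mul_nonneg (sq_nonneg _) (hg0 k)
  have hgn := hlow n hn
  have hgn0 := hg0 n
  -- `g n · n · Σ ≥ (c/(n√n)) · n · (2n · c/(2√n)) = c²`
  have hmain : c ^ 2 ≤ g n * ((n : ℝ) * ∑ k ∈ Finset.Icc 1 (2 * n), (k : ℝ) * g k) := by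
    have hdiv : c / (2 * Real.sqrt n) = c * Real.sqrt n / (2 * n) := by
      rw [div_eq_div_iff (by positivity) (by positivity)]
      linear_combination (-2 * c) * Real.mul_self_sqrt hn0.le
    have h2 : c * Real.sqrt n ≤ ∑ k ∈ Finset.Icc 1 (2 * n), (k : ℝ) * g k := by
      calc c * Real.sqrt n = (2 * n : ℕ) * (c / (2 * Real.sqrt n)) := by
            rw [hdiv]
            push_cast
            field_simp
        _ ≤ _ := hsum
    calc c ^ 2 = c * c := sq c
      _ ≤ ((n : ℝ) * Real.sqrt n * g n) * c := by nlinarith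
      _ = g n * ((n : ℝ) * (c * Real.sqrt n)) := by ring
      _ ≤ g n * ((n : ℝ) * ∑ k ∈ Finset.Icc 1 (2 * n), (k : ℝ) * g k) := by
          refine mul_le_mul_of_nonneg_left (mul_le_mul_of_nonneg_left h2 hn0.le) hgn0
  calc c ^ 2 ≤ g n * ((n : ℝ) * ∑ k ∈ Finset.Icc 1 (2 * n), (k : ℝ) * g k) := hmain
    _ ≤ _ := by
        refine mul_le_mul_of_nonneg_left ?_ hgn0
        linarith

/-! ## §3 The witness: a lacunary mixture of massive episodes -/

namespace AxisProfileNoDoubling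

/-- The weights `w i = 2^{-i²}` of the episodes. [folklore] -/
def w (i : ℕ) : ℝ := (1 / 2 : ℝ) ^ (i ^ 2)

/-- The masses `s i = 2^{-4i²} = 1/M_i` of the episodes (`M_i = 2^{4i²}` is the `i`-th scale). [folklore] -/
def s (i : ℕ) : ℝ := (1 / 2 : ℝ) ^ (4 * i ^ 2)

/-- The `i`-th summand of the level function at `n`: `w_i (e^{-s_i n} − e^{-3n})`
(`= w_i · n ∫_{s_i}^{3} e^{-an} da` for `n ≥ 1`). [folklore] -/
def term (n i : ℕ) : ℝ := w i * (Real.exp (-(s i * n)) - Real.exp (-(3 * n)))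

/-- The level function `h(n) = Σ_i w_i (e^{-s_i n} − e^{-3n})` (`= n Z g(n)` for `n ≥ 1`). [folklore] -/
def level (n : ℕ) : ℝ := ∑' i, term n i

/-- The normalisation `Z = Σ_i w_i (3 − s_i)` (total mass of the un-normalised spectral measure). [folklore] -/
def Z : ℝ := ∑' i, w i * (3 - s i)

/-- **The witness profile** `g(0) = 1`, `g(n) = h(n)/(n Z)` for `n ≥ 1`, i.e.
`g(n) = (nZ)⁻¹ Σ_i 2^{-i²}(e^{-n 2^{-4i²}} − e^{-3n})`. [folklore] -/
def g (n : ℕ) : ℝ := if n = 0 then 1 else level n / (n * Z)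

/-! ### Elementary bounds on the weights and masses -/

/-- The weights are positive. [folklore] -/
theorem w_pos (i : ℕ) : 0 < w i := by unfold w; positivity

/-- `w 0 = 1`. [folklore] -/
theorem w_zero : w 0 = 1 := by simp [w]

/-- `w i ≤ 1`. [folklore] -/
theorem w_le_one (i : ℕ) : w i ≤ 1 := by
  unfold w; exact pow_le_one₀ (by norm_num) (by norm_num)

/-- `w (i+1) = w i · 2^{-(2i+1)}`. [folklore] -/
theorem w_succ (i : ℕ) : w (i + 1) = w i * (1 / 2 : ℝ) ^ (2 * i + 1) := by
  unfold w
  rw [← pow_add]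
  congr 1
  ring

/-- `w (i+1) ≤ w i / 2` (lacunarity). [folklore] -/
theorem w_succ_le (i : ℕ) : w (i + 1) ≤ w i / 2 := by
  rw [w_succ]
  have h1 : (1 / 2 : ℝ) ^ (2 * i + 1) ≤ 1 / 2 := by
    calc (1 / 2 : ℝ) ^ (2 * i + 1) ≤ (1 / 2 : ℝ) ^ 1 :=
          pow_le_pow_of_le_one (by norm_num) (by norm_num) (by omega)
      _ = 1 / 2 := pow_one _
  have := w_pos i
  calc w i * (1 / 2 : ℝ) ^ (2 * i + 1) ≤ w i * (1 / 2) := mul_le_mul_of_nonneg_left h1 this.le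
    _ = w i / 2 := by ring

/-- The tail weights decay geometrically: `w (j + i) ≤ w i · 2^{-j}`. [folklore] -/
theorem w_add_le (i j : ℕ) : w (j + i) ≤ w i * (1 / 2 : ℝ) ^ j := by
  induction j with
  | zero => simp
  | succ j ih =>
      rw [show j + 1 + i = (j + i) + 1 by ring]
      calc w (j + i + 1) ≤ w (j + i) / 2 := w_succ_le _
        _ ≤ w i * (1 / 2 : ℝ) ^ j / 2 := by linarith
        _ = w i * (1 / 2 : ℝ) ^ (j + 1) := by rw [pow_succ]; ring

/-- `w i ≤ 2^{-i}`. [folklore] -/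
theorem w_le_geom (i : ℕ) : w i ≤ (1 / 2 : ℝ) ^ i := by
  simpa [w_zero] using w_add_le 0 i

/-- The geometric series `Σ 2^{-i}` converges. [folklore] -/
theorem summable_geom_half : Summable fun i : ℕ => (1 / 2 : ℝ) ^ i :=
  summable_geometric_of_lt_one (by norm_num) (by norm_num)

/-- The weights are summable. [folklore] -/
theorem summable_w : Summable w :=
  Summable.of_nonneg_of_le (fun i => (w_pos i).le) w_le_geom summable_geom_half

/-- `Σ_i w_i ≤ 2`. [folklore] -/
theorem tsum_w_le_two : ∑' i, w i ≤ 2 := by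
  calc ∑' i, w i ≤ ∑' i : ℕ, (1 / 2 : ℝ) ^ i :=
        Summable.tsum_le_tsum w_le_geom summable_w summable_geom_half
    _ = 2 := by rw [tsum_geometric_of_lt_one (by norm_num) (by norm_num)]; norm_num

/-- A shifted tail: `Σ_j w (j + i) ≤ 2 w i`. [folklore] -/
theorem tsum_w_add_le (i : ℕ) : ∑' j, w (j + i) ≤ 2 * w i := by
  have hs : Summable fun j => w i * (1 / 2 : ℝ) ^ j := summable_geom_half.mul_left _
  have hs' : Summable fun j => w (j + i) :=
    Summable.of_nonneg_of_le (fun j => (w_pos _).le) (w_add_le i) hs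
  calc ∑' j, w (j + i) ≤ ∑' j, w i * (1 / 2 : ℝ) ^ j := Summable.tsum_le_tsum (w_add_le i) hs' hs
    _ = w i * 2 := by
        rw [tsum_mul_left, tsum_geometric_of_lt_one (by norm_num) (by norm_num)]; norm_num
    _ = 2 * w i := by ring

/-- The masses are positive. [folklore] -/
theorem s_pos (i : ℕ) : 0 < s i := by unfold s; positivity

/-- `s 0 = 1`. [folklore] -/
theorem s_zero : s 0 = 1 := by simp [s]

/-- `s i ≤ 1`. [folklore] -/
theorem s_le_one (i : ℕ) : s i ≤ 1 := by
  unfold s; exact pow_le_one₀ (by norm_num) (by norm_num)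

/-- The masses decrease with the episode index. [folklore] -/
theorem s_antitone : Antitone s := by
  intro i j hij
  unfold s
  exact pow_le_pow_of_le_one (by norm_num) (by norm_num)
    (Nat.mul_le_mul_left 4 (Nat.pow_le_pow_left hij 2))

/-! ### The summands and the level function -/

/-- The summands are non-negative (`s_i ≤ 3`). [folklore] -/
theorem term_nonneg (n i : ℕ) : 0 ≤ term n i := by
  unfold term
  refine mul_nonneg (w_pos i).le (sub_nonneg.2 (Real.exp_le_exp.2 ?_))
  have h1 := s_le_one i
  have hn : (0 : ℝ) ≤ n := Nat.cast_nonneg n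
  nlinarith

/-- The summands are at most the weights. [folklore] -/
theorem term_le_w (n i : ℕ) : term n i ≤ w i := by
  unfold term
  have h1 : Real.exp (-(s i * n)) ≤ 1 := by
    rw [Real.exp_le_one_iff]
    have := s_pos i
    have hn : (0 : ℝ) ≤ n := Nat.cast_nonneg n
    nlinarith
  have h2 : 0 < Real.exp (-(3 * (n : ℝ))) := Real.exp_pos _
  have := w_pos i
  nlinarith

/-- `term n i ≤ w_i e^{-s_i n}`. [folklore] -/
theorem term_le_w_mul_exp (n i : ℕ) : term n i ≤ w i * Real.exp (-(s i * n)) := by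
  unfold term
  have h2 : 0 < Real.exp (-(3 * (n : ℝ))) := Real.exp_pos _
  have := w_pos i
  nlinarith

/-- The level series converges. [folklore] -/
theorem summable_term (n : ℕ) : Summable (term n) :=
  Summable.of_nonneg_of_le (term_nonneg n) (term_le_w n) summable_w

/-- `0 ≤ h(n)`. [folklore] -/
theorem level_nonneg (n : ℕ) : 0 ≤ level n := tsum_nonneg (term_nonneg n)

/-- `h(n) ≤ Σ_i w_i ≤ 2`. [folklore] -/
theorem level_le_two (n : ℕ) : level n ≤ 2 :=
  (Summable.tsum_le_tsum (term_le_w n) (summable_term n) summable_w).trans tsum_w_le_two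

/-- The first summand bounds the level function below: `e^{-n} − e^{-3n} ≤ h(n)`. [folklore] -/
theorem term_zero_le_level (n : ℕ) : Real.exp (-(n : ℝ)) - Real.exp (-(3 * n)) ≤ level n := by
  have h := Summable.le_tsum (summable_term n) 0 (fun j _ => term_nonneg n j)
  have h0 : term n 0 = Real.exp (-(n : ℝ)) - Real.exp (-(3 * n)) := by
    simp [term, w_zero, s_zero]
  rw [h0] at h
  exact h

/-- Any single summand bounds the level function below. [folklore] -/
theorem term_le_level (n i : ℕ) : term n i ≤ level n :=
  Summable.le_tsum (summable_term n) i (fun j _ => term_nonneg n j)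

/-- `0 < h(n)` for `n ≥ 1`. [folklore] -/
theorem level_pos {n : ℕ} (hn : 1 ≤ n) : 0 < level n := by
  refine lt_of_lt_of_le ?_ (term_zero_le_level n)
  have : Real.exp (-(3 * (n : ℝ))) < Real.exp (-(n : ℝ)) := by
    rw [Real.exp_lt_exp]
    have : (1 : ℝ) ≤ n := by exact_mod_cast hn
    linarith
  linarith

/-! ### The normalisation `Z ∈ [2, 6]` -/

/-- The normalisation series converges. [folklore] -/
theorem summable_Z : Summable fun i => w i * (3 - s i) := by
  refine Summable.of_nonneg_of_le (fun i => ?_) (fun i => ?_) (summable_w.mul_left 3)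
  · exact mul_nonneg (w_pos i).le (by linarith [s_le_one i])
  · have := w_pos i
    have := s_pos i
    nlinarith

/-- `2 ≤ Z` (the first episode alone contributes `3 − 1`). [folklore] -/
theorem two_le_Z : 2 ≤ Z := by
  have := Summable.le_tsum summable_Z 0
    (fun j _ => mul_nonneg (w_pos j).le (by linarith [s_le_one j]))
  simp only [w_zero, s_zero, one_mul] at this
  unfold Z
  linarith

/-- `Z ≤ 3 Σ_i w_i ≤ 6`. [folklore] -/
theorem Z_le_six : Z ≤ 6 := by
  unfold Z
  calc ∑' i, w i * (3 - s i) ≤ ∑' i, 3 * w i := by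
        refine Summable.tsum_le_tsum (fun i => ?_) summable_Z (summable_w.mul_left 3)
        have := w_pos i
        have := s_pos i
        nlinarith
    _ = 3 * ∑' i, w i := tsum_mul_left
    _ ≤ 6 := by linarith [tsum_w_le_two]

/-- `0 < Z`. [folklore] -/
theorem Z_pos : 0 < Z := by linarith [two_le_Z]

/-! ### Values of the witness -/

/-- `g(0) = 1`. [folklore] -/
theorem g_zero : g 0 = 1 := by simp [g]

/-- `g(n) = h(n)/(nZ)` for `n ≥ 1`. [folklore] -/
theorem g_of_pos {n : ℕ} (hn : 1 ≤ n) : g n = level n / (n * Z) := by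
  simp [g, show n ≠ 0 by omega]

/-- The witness is positive. [folklore] -/
theorem g_pos (n : ℕ) : 0 < g n := by
  rcases Nat.eq_zero_or_pos n with rfl | hn
  · rw [g_zero]; exact one_pos
  · rw [g_of_pos hn]
    have : (0 : ℝ) < n := by exact_mod_cast hn
    exact div_pos (level_pos hn) (mul_pos this Z_pos)

/-- `n g(n) = h(n)/Z` for `n ≥ 1`. [folklore] -/
theorem level_eq {n : ℕ} (hn : 1 ≤ n) : (n : ℝ) * g n = level n / Z := by
  rw [g_of_pos hn]
  have : (n : ℝ) ≠ 0 := by exact_mod_cast (show n ≠ 0 by omega)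
  field_simp

/-! ### The spectral measure of the witness -/

/-- **The spectral measure of the witness**: `μ = Z⁻¹ Σ_i w_i · Leb|[s_i, 3]`, a probability measure
on `[0, 3]` (mass `e^{-a}`-profiles with masses `a ∈ [2^{-4i²}, 3]`, weight `2^{-i²}/Z` each). [folklore] -/
def μ : Measure ℝ :=
  Measure.sum fun i : ℕ => ENNReal.ofReal (w i / Z) • (volume.restrict (Set.Icc (s i) 3))

/-- `s i ≤ 3` (the pieces `[s_i, 3]` are non-empty). [folklore] -/
theorem s_le_three (i : ℕ) : s i ≤ 3 := (s_le_one i).trans (by norm_num)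

/-- The normalised weights are non-negative. [folklore] -/
theorem w_div_Z_nonneg (i : ℕ) : 0 ≤ w i / Z := div_nonneg (w_pos i).le Z_pos.le

/-- The pieces of `μ` do not charge `(-∞, 0)`. [folklore] -/
theorem μ_compl_Ici : μ (Set.Ici (0 : ℝ))ᶜ = 0 := by
  rw [μ, Measure.sum_apply_of_countable]
  refine ENNReal.tsum_eq_zero.2 fun i => ?_
  rw [Measure.smul_apply, Measure.restrict_apply (measurableSet_Ici.compl), smul_eq_mul]
  have : (Set.Ici (0 : ℝ))ᶜ ∩ Set.Icc (s i) 3 = ∅ := by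
    ext a
    simp only [Set.mem_inter_iff, Set.mem_compl_iff, Set.mem_Ici, not_le, Set.mem_Icc,
      Set.mem_empty_iff_false, iff_false, not_and, not_le]
    intro ha hsa
    have := s_pos i
    linarith
  rw [this, measure_empty, mul_zero]

/-- `μ` is a probability measure: `μ(ℝ) = Z⁻¹ Σ_i w_i (3 − s_i) = 1`. [folklore] -/
theorem μ_univ : μ Set.univ = 1 := by
  rw [μ, Measure.sum_apply_of_countable]
  have h1 : ∀ i : ℕ, (ENNReal.ofReal (w i / Z) • volume.restrict (Set.Icc (s i) 3)) Set.univ =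
      ENNReal.ofReal (w i * (3 - s i) / Z) := by
    intro i
    rw [Measure.smul_apply, Measure.restrict_apply MeasurableSet.univ, Set.univ_inter,
      Real.volume_Icc, smul_eq_mul, ← ENNReal.ofReal_mul (w_div_Z_nonneg i)]
    congr 1
    ring
  simp_rw [h1]
  have hnn : ∀ i, 0 ≤ w i * (3 - s i) / Z := fun i =>
    div_nonneg (mul_nonneg (w_pos i).le (by linarith [s_le_one i])) Z_pos.le
  rw [← ENNReal.ofReal_tsum_of_nonneg hnn (summable_Z.div_const Z), tsum_div_const]
  rw [show (∑' i, w i * (3 - s i)) = Z from rfl, div_self Z_pos.ne', ENNReal.ofReal_one]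

/-- The spectral measure of the witness is a probability measure. [folklore] -/
instance : IsProbabilityMeasure μ := ⟨μ_univ⟩

/-- `μ`-almost every mass is non-negative. [folklore] -/
theorem ae_nonneg_μ : ∀ᵐ a ∂μ, 0 ≤ a := by
  have : ∀ᵐ a ∂μ, a ∉ (Set.Ici (0 : ℝ))ᶜ := measure_eq_zero_iff_ae_notMem.1 μ_compl_Ici
  filter_upwards [this] with a ha
  simpa using ha

/-- The Laplace transform of one piece, `n ≥ 1`: `∫_{[s_i,3]} e^{-an} da = (e^{-s_i n} − e^{-3n})/n`.
[folklore] -/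
theorem integral_piece {n : ℕ} (hn : 1 ≤ n) (i : ℕ) :
    ∫ a in Set.Icc (s i) 3, Real.exp (-(a * n)) =
      (Real.exp (-(s i * n)) - Real.exp (-(3 * n))) / n := by
  rw [integral_Icc_eq_integral_Ioc, ← intervalIntegral.integral_of_le (s_le_three i)]
  have hn0 : (n : ℝ) ≠ 0 := by exact_mod_cast (show n ≠ 0 by omega)
  have hderiv : ∀ x ∈ Set.uIcc (s i) 3,
      HasDerivAt (fun a : ℝ => -Real.exp (-(a * n)) / n) (Real.exp (-(x * n))) x := by
    intro x _
    have h1 : HasDerivAt (fun a : ℝ => -(a * n)) (-(1 * (n : ℝ))) x :=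
      ((hasDerivAt_id x).mul_const (n : ℝ)).neg
    have h2 : HasDerivAt (fun a : ℝ => Real.exp (-(a * n))) (Real.exp (-(x * n)) * -(1 * (n : ℝ))) x :=
      h1.exp
    have h3 := h2.neg.div_const (n : ℝ)
    refine h3.congr_deriv ?_
    rw [one_mul, mul_neg, neg_neg, mul_div_assoc, div_self hn0, mul_one]
  rw [intervalIntegral.integral_eq_sub_of_hasDerivAt hderiv
    (by apply Continuous.intervalIntegrable; fun_prop)]
  field_simp
  ring

/-- The Laplace transform of one piece at `n = 0`: `∫_{[s_i,3]} 1 da = 3 − s_i`. [folklore] -/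
theorem integral_piece_zero (i : ℕ) :
    ∫ a in Set.Icc (s i) 3, Real.exp (-(a * ((0 : ℕ) : ℝ))) = 3 - s i := by
  simp only [Nat.cast_zero, mul_zero, neg_zero, Real.exp_zero]
  rw [setIntegral_const, Real.volume_real_Icc_of_le (s_le_three i), smul_eq_mul, mul_one]

/-- The exponential profile is `μ`-integrable (bounded by `1` a.e., `μ` finite). [folklore] -/
theorem integrable_exp_μ (n : ℕ) : Integrable (fun a : ℝ => Real.exp (-(a * n))) μ := by
  refine Integrable.mono' (integrable_const (1 : ℝ)) (by fun_prop) ?_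
  filter_upwards [ae_nonneg_μ] with a ha
  rw [Real.norm_eq_abs, abs_of_pos (Real.exp_pos _), Real.exp_le_one_iff]
  have : (0 : ℝ) ≤ a * n := by positivity
  linarith

/-- **The witness has the Källén–Lehmann shape**: `g(n) = ∫ e^{-an} dμ(a)` for every `n`,
with `μ` the probability measure above, carried by `[0, 3]`. [folklore] -/
theorem g_eq_integral (n : ℕ) : g n = ∫ a, Real.exp (-(a * n)) ∂μ := by
  rw [μ, integral_sum_measure (by simpa [μ] using integrable_exp_μ n)]
  simp_rw [integral_smul_measure, ENNReal.toReal_ofReal (w_div_Z_nonneg _), smul_eq_mul]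
  rcases Nat.eq_zero_or_pos n with rfl | hn
  · simp_rw [integral_piece_zero]
    rw [g_zero]
    have : ∀ i, w i / Z * (3 - s i) = w i * (3 - s i) / Z := fun i => by ring
    simp_rw [this]
    rw [tsum_div_const, show (∑' i, w i * (3 - s i)) = Z from rfl, div_self Z_pos.ne']
  · simp_rw [integral_piece hn]
    rw [g_of_pos hn]
    have hn0 : (n : ℝ) ≠ 0 := by exact_mod_cast (show n ≠ 0 by omega)
    have : ∀ i, w i / Z * ((Real.exp (-(s i * n)) - Real.exp (-(3 * n))) / n) =
        term n i / (n * Z) := by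
      intro i
      unfold term
      field_simp
    simp_rw [this]
    rw [tsum_div_const]
    rfl

/-- **Spectral representation of the witness** (the `HasAxisSpectralRepresentation` clause). [folklore] -/
theorem hasAxisSpectralRepresentation_g : HasAxisSpectralRepresentation g :=
  ⟨μ, inferInstance, μ_compl_Ici, g_eq_integral⟩

/-! ### Numerical constants -/

/-- `2 ≤ e`. [folklore] -/
theorem two_le_exp_one : (2 : ℝ) ≤ Real.exp 1 := by
  have := Real.add_one_le_exp (1 : ℝ); linarith

/-- `e^{-1} ≤ 1/2`. [folklore] -/
theorem exp_neg_one_le_half : Real.exp (-1) ≤ 1 / 2 := by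
  rw [Real.exp_neg, inv_le_comm₀ (Real.exp_pos _) (by norm_num)]
  norm_num
  exact two_le_exp_one

/-- `e^{-1} − e^{-3} ≥ 1/4` (`e ∈ (2.718, 2.719)`). [folklore] -/
theorem quarter_le_exp_neg_one_sub : (1 / 4 : ℝ) ≤ Real.exp (-1) - Real.exp (-3) := by
  set y : ℝ := Real.exp (-1) with hy
  have hy3 : Real.exp (-3) = y ^ 3 := by
    rw [hy, ← Real.exp_nat_mul]; norm_num
  have hlo : (0.36 : ℝ) ≤ y := by
    have h := Real.exp_one_lt_d9
    have h' : (2.7182818286 : ℝ)⁻¹ < (Real.exp 1)⁻¹ :=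
      (inv_lt_inv₀ (by norm_num) (Real.exp_pos 1)).2 h
    rw [hy, Real.exp_neg]
    have h2 : (0.36 : ℝ) ≤ (2.7182818286 : ℝ)⁻¹ := by norm_num
    linarith
  have hhi : y ≤ 0.38 := by
    have h := Real.exp_one_gt_d9
    have : y < (2.7182818283 : ℝ)⁻¹ := by
      rw [hy, Real.exp_neg]
      exact (inv_lt_inv₀ (Real.exp_pos 1) (by norm_num)).2 h
    have h2 : (2.7182818283 : ℝ)⁻¹ ≤ 0.38 := by norm_num
    linarith
  have hy0 : 0 ≤ y := (Real.exp_pos _).le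
  have hsq : y ^ 2 ≤ 0.1444 := by nlinarith
  have hcube : y ^ 3 ≤ 0.1444 * y := by nlinarith [mul_le_mul_of_nonneg_left hsq hy0]
  rw [hy3]
  linarith

/-! ### The level function is non-increasing -/

/-- **`h(n+1) ≤ h(n)` for `n ≥ 1`**: the first episode's decrement `e^{-n}(1 − e^{-1})` beats the total
cut-off increment `Σ_i w_i e^{-3n}(1 − e^{-3}) ≤ 2e^{-3n}`. [folklore] -/
theorem level_succ_le {n : ℕ} (hn : 1 ≤ n) : level (n + 1) ≤ level n := by
  set x : ℝ := Real.exp (-(n : ℝ)) with hx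
  have hx0 : 0 < x := Real.exp_pos _
  have hxle : x ≤ 1 / 2 := by
    calc x ≤ Real.exp (-1) := Real.exp_le_exp.2 (by
          have : (1 : ℝ) ≤ n := by exact_mod_cast hn
          linarith)
      _ ≤ 1 / 2 := exp_neg_one_le_half
  set A : ℕ → ℝ := fun i => w i * Real.exp (-(s i * n)) * (1 - Real.exp (-(s i))) with hA
  set B : ℕ → ℝ := fun i => w i * (Real.exp (-(3 * (n : ℝ))) * (1 - Real.exp (-3))) with hB
  have hAB : ∀ i, term n i - term (n + 1) i = A i - B i := by
    intro i
    simp only [term, hA, hB]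
    push_cast
    have e1 : Real.exp (-(s i * (n + 1))) = Real.exp (-(s i * n)) * Real.exp (-(s i)) := by
      rw [← Real.exp_add]; ring_nf
    have e2 : Real.exp (-(3 * ((n : ℝ) + 1))) = Real.exp (-(3 * n)) * Real.exp (-3) := by
      rw [← Real.exp_add]; ring_nf
    rw [e1, e2]; ring
  have hA0 : ∀ i, 0 ≤ A i := by
    intro i
    simp only [hA]
    refine mul_nonneg (mul_nonneg (w_pos i).le (Real.exp_pos _).le) ?_
    rw [sub_nonneg, Real.exp_le_one_iff]
    linarith [s_pos i]
  have hAle : ∀ i, A i ≤ w i := by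
    intro i
    simp only [hA]
    have h1 : Real.exp (-(s i * n)) ≤ 1 := by
      rw [Real.exp_le_one_iff]
      have := s_pos i
      have : (0 : ℝ) ≤ n := Nat.cast_nonneg n
      nlinarith
    have h2 : 1 - Real.exp (-(s i)) ≤ 1 := by linarith [Real.exp_pos (-(s i))]
    have h3 : 0 ≤ 1 - Real.exp (-(s i)) := by
      rw [sub_nonneg, Real.exp_le_one_iff]; linarith [s_pos i]
    calc w i * Real.exp (-(s i * n)) * (1 - Real.exp (-(s i)))
        ≤ w i * 1 * 1 := by
          refine mul_le_mul (mul_le_mul_of_nonneg_left h1 (w_pos i).le) h2 h3 ?_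
          exact mul_nonneg (w_pos i).le zero_le_one
      _ = w i := by ring
  have hsA : Summable A := Summable.of_nonneg_of_le hA0 hAle summable_w
  have hsB : Summable B := summable_w.mul_right _
  have hdiff : level n - level (n + 1) = ∑' i, A i - ∑' i, B i := by
    rw [level, level, ← (summable_term n).tsum_sub (summable_term (n + 1)), ← hsA.tsum_sub hsB]
    exact tsum_congr hAB
  have hA_ge : x * (1 - Real.exp (-1)) ≤ ∑' i, A i := by
    have := hsA.le_tsum 0 (fun j _ => hA0 j)
    simpa [hA, w_zero, s_zero] using this
  have hB_le : ∑' i, B i ≤ 2 * x ^ 3 := by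
    have hB_eq : ∑' i, B i = (∑' i, w i) * (Real.exp (-(3 * (n : ℝ))) * (1 - Real.exp (-3))) :=
      tsum_mul_right
    have h3 : Real.exp (-(3 * (n : ℝ))) = x ^ 3 := by
      rw [hx, ← Real.exp_nat_mul]; ring_nf
    have h4 : 0 ≤ 1 - Real.exp (-3) := by
      rw [sub_nonneg, Real.exp_le_one_iff]; norm_num
    have h5 : 1 - Real.exp (-3) ≤ 1 := by linarith [Real.exp_pos (-3 : ℝ)]
    rw [hB_eq, h3]
    calc (∑' i, w i) * (x ^ 3 * (1 - Real.exp (-3))) ≤ 2 * (x ^ 3 * 1) := by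
          refine mul_le_mul tsum_w_le_two (mul_le_mul_of_nonneg_left h5 (by positivity)) ?_ (by norm_num)
          positivity
      _ = 2 * x ^ 3 := by ring
  have hkey : 2 * x ^ 3 ≤ x * (1 - Real.exp (-1)) := by
    have h1 : x ^ 2 ≤ 1 / 4 := by nlinarith
    have h2 : 1 / 2 ≤ 1 - Real.exp (-1) := by linarith [exp_neg_one_le_half]
    nlinarith
  linarith

/-- The level function is non-increasing on `n ≥ 1`: `h(b) ≤ h(a)` for `1 ≤ a ≤ b`. [folklore] -/
theorem level_le_level {a b : ℕ} (ha : 1 ≤ a) (hab : a ≤ b) : level b ≤ level a := by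
  induction b, hab using Nat.le_induction with
  | base => exact le_rfl
  | succ m ham ih => exact (level_succ_le (ha.trans ham)).trans ih

/-- **`k g(k)` is non-increasing** (the strong profile form of the sliding-scale bound). [folklore] -/
theorem level_antitone_g (n : ℕ) (hn : 1 ≤ n) : ((n : ℝ) + 1) * g (n + 1) ≤ n * g n := by
  have h1 : (((n + 1 : ℕ) : ℝ)) * g (n + 1) = level (n + 1) / Z := level_eq (by omega)
  push_cast at h1
  rw [h1, level_eq hn]
  exact div_le_div_of_nonneg_right (level_succ_le hn) Z_pos.le

/-- **The level envelope with `C = 1`**: `n g(n) = h(n)/Z ≤ 2/2`. [folklore] -/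
theorem upper_g (n : ℕ) (hn : 1 ≤ n) : (n : ℝ) * g n ≤ 1 := by
  rw [level_eq hn, div_le_one Z_pos]
  linarith [level_le_two n, two_le_Z]

/-- **The witness is non-increasing** (MMS clause). [folklore] -/
theorem antitone_g : Antitone g := by
  refine antitone_nat_of_succ_le fun n => ?_
  rcases Nat.eq_zero_or_pos n with rfl | hn
  · rw [g_zero]
    simpa using upper_g 1 le_rfl
  · have h := level_antitone_g n hn
    have hn0 : (0 : ℝ) < n := by exact_mod_cast hn
    have hg := (g_pos (n + 1)).le
    nlinarith

/-! ### The DCP-fat lower envelope at every scale -/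

/-- **`g(n) ≥ n^{-3/2}/96` for all `n ≥ 1`**: at scale `n ∈ (M_{j-1}, M_j]` the `j`-th episode is still on
its plateau (`e^{-s_j n} ≥ e^{-1}`) and carries weight `w_j ≥ ¼ M_{j-1}^{-1/2} ≥ ¼ n^{-1/2}`. [folklore] -/
theorem lower_threeHalves_g (n : ℕ) (hn : 1 ≤ n) : (1 / 96 : ℝ) ≤ n * Real.sqrt n * g n := by
  have hn0 : (0 : ℝ) < n := by exact_mod_cast hn
  have hn1 : (1 : ℝ) ≤ n := by exact_mod_cast hn
  -- the first episode whose plateau contains `n`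
  have hex : ∃ j : ℕ, (n : ℝ) * s j ≤ 1 := by
    refine ⟨n, ?_⟩
    unfold s
    have h1 : (1 / 2 : ℝ) ^ (4 * n ^ 2) ≤ (1 / 2 : ℝ) ^ n :=
      pow_le_pow_of_le_one (by norm_num) (by norm_num) (by nlinarith)
    have h2 : (n : ℝ) * (1 / 2 : ℝ) ^ n ≤ 1 := by
      rw [one_div_pow, mul_one_div, div_le_one (by positivity)]
      exact_mod_cast (Nat.lt_two_pow_self).le
    calc (n : ℝ) * (1 / 2 : ℝ) ^ (4 * n ^ 2) ≤ n * (1 / 2 : ℝ) ^ n :=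
          mul_le_mul_of_nonneg_left h1 hn0.le
      _ ≤ 1 := h2
  classical
  set j := Nat.find hex with hj
  have hjle : (n : ℝ) * s j ≤ 1 := Nat.find_spec hex
  -- the `j`-th summand is at least `w_j / 4`
  have hterm : w j / 4 ≤ term n j := by
    unfold term
    have h1 : Real.exp (-1) ≤ Real.exp (-(s j * n)) := Real.exp_le_exp.2 (by nlinarith)
    have h2 : Real.exp (-(3 * (n : ℝ))) ≤ Real.exp (-3) := Real.exp_le_exp.2 (by nlinarith)
    have h3 := quarter_le_exp_neg_one_sub
    have := w_pos j
    nlinarith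
  have hlev : w j / 4 ≤ level n := hterm.trans (term_le_level n j)
  -- `√n · w_j ≥ 1/4`
  have hsw : (1 / 4 : ℝ) ≤ Real.sqrt n * w j := by
    rcases Nat.eq_zero_or_pos j with hj0 | hjpos
    · rw [hj0, w_zero, mul_one]
      exact le_trans (by norm_num) (Real.one_le_sqrt.2 hn1)
    · obtain ⟨m, hm⟩ : ∃ m, j = m + 1 := ⟨j - 1, by omega⟩
      have hmin : ¬ ((n : ℝ) * s m ≤ 1) := Nat.find_min hex (by rw [← hj]; omega)
      push Not at hmin
      -- `n ≥ 2^{4m²}`, so `√n ≥ 2^{2m²}`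
      have hnge : (2 : ℝ) ^ (4 * m ^ 2) ≤ n := by
        unfold s at hmin
        rw [one_div_pow, mul_one_div, lt_div_iff₀ (by positivity), one_mul] at hmin
        exact hmin.le
      have hsq : (2 : ℝ) ^ (2 * m ^ 2) ≤ Real.sqrt n := by
        calc (2 : ℝ) ^ (2 * m ^ 2) = Real.sqrt (((2 : ℝ) ^ (2 * m ^ 2)) ^ 2) :=
              (Real.sqrt_sq (by positivity)).symm
          _ ≤ Real.sqrt n := Real.sqrt_le_sqrt (by
              rw [← pow_mul, show 2 * m ^ 2 * 2 = 4 * m ^ 2 by ring]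
              exact hnge)
      -- `w_{m+1} 2^{2m²} ≥ 1/4`
      have hexp : (m + 1) ^ 2 ≤ 2 * m ^ 2 + 2 := by
        cases m with
        | zero => norm_num
        | succ k => ring_nf; nlinarith [Nat.zero_le k]
      have hw : (1 / 4 : ℝ) ≤ (2 : ℝ) ^ (2 * m ^ 2) * w (m + 1) := by
        unfold w
        rw [one_div_pow, mul_one_div, le_div_iff₀ (by positivity)]
        calc (1 / 4 : ℝ) * 2 ^ ((m + 1) ^ 2) ≤ (1 / 4) * 2 ^ (2 * m ^ 2 + 2) := by
              refine mul_le_mul_of_nonneg_left ?_ (by norm_num)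
              exact pow_le_pow_right₀ (by norm_num) hexp
          _ = 2 ^ (2 * m ^ 2) := by rw [pow_add]; ring
      rw [hm]
      calc (1 / 4 : ℝ) ≤ (2 : ℝ) ^ (2 * m ^ 2) * w (m + 1) := hw
        _ ≤ Real.sqrt n * w (m + 1) := mul_le_mul_of_nonneg_right hsq (w_pos _).le
  -- assemble: `n √n g n = √n h(n) / Z ≥ √n (w_j/4) / 6`
  have hsq0 : 0 ≤ Real.sqrt n := Real.sqrt_nonneg _
  calc (1 / 96 : ℝ) ≤ Real.sqrt n * (w j / 4) / 6 := by nlinarith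
    _ ≤ Real.sqrt n * level n / Z := by
        rw [div_le_div_iff₀ (by norm_num) Z_pos]
        have := mul_le_mul_of_nonneg_left hlev hsq0
        have hZ := Z_le_six
        have : 0 ≤ Real.sqrt n * level n := mul_nonneg hsq0 (level_nonneg n)
        nlinarith
    _ = n * Real.sqrt n * g n := by
        rw [mul_assoc, mul_comm (n : ℝ), mul_assoc, mul_comm (g n), level_eq hn]
        ring

/-! ### Doubling fails along the episode ends `nᵢ = i · 2^{4i²}` -/

/-- `e^{-t} ≤ 2^{-t}` for natural `t`. [folklore] -/
theorem exp_neg_nat_le_half_pow (t : ℕ) : Real.exp (-(t : ℝ)) ≤ (1 / 2 : ℝ) ^ t := by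
  rw [show (-(t : ℝ)) = t * (-1) by ring, Real.exp_nat_mul]
  exact pow_le_pow_left₀ (Real.exp_pos _).le exp_neg_one_le_half t

/-- The scale at which the `p`-th episode has decayed by `e^{-p}`: `n_p = p · M_p = p · 2^{4p²}`. [folklore] -/
def nEp (p : ℕ) : ℕ := p * 2 ^ (4 * p ^ 2)

/-- `n_p ≥ 1` for `p ≥ 1`. [folklore] -/
theorem one_le_nEp {p : ℕ} (hp : 1 ≤ p) : 1 ≤ nEp p :=
  Nat.mul_le_mul hp Nat.one_le_two_pow

/-- `p ≤ n_p`. [folklore] -/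
theorem le_nEp (p : ℕ) : p ≤ nEp p := Nat.le_mul_of_pos_right p Nat.one_le_two_pow

/-- `s_p · n_p = p`. [folklore] -/
theorem s_mul_nEp (p : ℕ) : s p * (nEp p : ℝ) = p := by
  unfold s nEp
  push_cast
  rw [one_div_pow]
  field_simp

/-- For the earlier episodes `j ≤ i`: `s_j · n_{i+1} ≥ (i+1) 2^{8i+4}` (they are deep in their
exponential tails at the scale of episode `i+1`). [folklore] -/
theorem s_mul_nEp_ge {i j : ℕ} (hj : j ≤ i) : ((i : ℝ) + 1) * 2 ^ (8 * i + 4) ≤ s j * (nEp (i + 1) : ℝ) := by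
  have h1 : s i ≤ s j := s_antitone hj
  have h2 : s i * (nEp (i + 1) : ℝ) = ((i : ℝ) + 1) * 2 ^ (8 * i + 4) := by
    unfold s nEp
    push_cast
    rw [show 4 * (i + 1) ^ 2 = 4 * i ^ 2 + (8 * i + 4) by ring, pow_add, one_div_pow]
    field_simp
  rw [← h2]
  exact mul_le_mul_of_nonneg_right h1 (Nat.cast_nonneg _)

/-- **The `p`-th episode is still alive at `n_p`**: `h(n_p) ≥ w_p e^{-p}/2`. [folklore] -/
theorem level_nEp_ge {p : ℕ} (hp : 1 ≤ p) : w p * Real.exp (-(p : ℝ)) / 2 ≤ level (nEp p) := by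
  refine le_trans ?_ (term_le_level (nEp p) p)
  unfold term
  rw [s_mul_nEp]
  have h3 : Real.exp (-(3 * (nEp p : ℝ))) ≤ Real.exp (-(p : ℝ)) / 2 := by
    have hle : (p : ℝ) ≤ nEp p := by exact_mod_cast le_nEp p
    have hp1 : (1 : ℝ) ≤ p := by exact_mod_cast hp
    calc Real.exp (-(3 * (nEp p : ℝ))) ≤ Real.exp (-(p : ℝ) + (-1)) := Real.exp_le_exp.2 (by linarith)
      _ = Real.exp (-(p : ℝ)) * Real.exp (-1) := Real.exp_add _ _
      _ ≤ Real.exp (-(p : ℝ)) * (1 / 2) :=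
          mul_le_mul_of_nonneg_left exp_neg_one_le_half (Real.exp_pos _).le
      _ = Real.exp (-(p : ℝ)) / 2 := by ring
  have := w_pos p
  have := Real.exp_pos (-(p : ℝ))
  nlinarith

/-- **Everything has decayed at `2 n_{i+1}`**: `h(2n_{i+1}) ≤ 4 w_{i+1} 4^{-(i+1)}` — the earlier
episodes are doubly-exponentially dead, episode `i+1` has lost a further factor `e^{-(i+1)} ≤ 4^{-(i+1)}`,
and the later plateaus weigh `Σ_{j ≥ i+2} w_j ≤ 2w_{i+2} = w_{i+1} 4^{-(i+1)}` (lacunarity). [folklore] -/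
theorem level_two_nEp_le (i : ℕ) :
    level (2 * nEp (i + 1)) ≤ 4 * (w (i + 1) * (1 / 4 : ℝ) ^ (i + 1)) := by
  set N : ℕ := 2 * nEp (i + 1) with hN
  set q : ℝ := w (i + 1) * (1 / 4 : ℝ) ^ (i + 1) with hq
  have hq0 : 0 ≤ q := mul_nonneg (w_pos _).le (by positivity)
  have hq4 : (1 / 2 : ℝ) ^ (2 * (i + 1)) = (1 / 4 : ℝ) ^ (i + 1) := by
    rw [pow_mul]; norm_num
  -- split the series after the index `i + 1`
  have hsplit : level N = ∑ j ∈ Finset.range (i + 2), term N j + ∑' j, term N (j + (i + 2)) :=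
    ((summable_term N).sum_add_tsum_nat_add (i + 2)).symm
  -- the tail: later plateaus
  have htail : ∑' j, term N (j + (i + 2)) ≤ q := by
    have hs1 : Summable fun j => term N (j + (i + 2)) :=
      (summable_term N).comp_injective (add_left_injective (i + 2))
    have hs2 : Summable fun j => w (j + (i + 2)) :=
      summable_w.comp_injective (add_left_injective (i + 2))
    calc ∑' j, term N (j + (i + 2)) ≤ ∑' j, w (j + (i + 2)) :=
          Summable.tsum_le_tsum (fun j => term_le_w N _) hs1 hs2
      _ ≤ 2 * w (i + 2) := tsum_w_add_le (i + 2)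
      _ = q := by
          rw [hq, show i + 2 = (i + 1) + 1 by ring, w_succ, ← hq4]; ring
  -- episode `i + 1` itself
  have hmid : term N (i + 1) ≤ q := by
    calc term N (i + 1) ≤ w (i + 1) * Real.exp (-(s (i + 1) * N)) := term_le_w_mul_exp N (i + 1)
      _ = w (i + 1) * Real.exp (-((2 * (i + 1) : ℕ) : ℝ)) := by
          rw [hN]; push_cast
          rw [show s (i + 1) * (2 * (nEp (i + 1) : ℝ)) = 2 * (s (i + 1) * (nEp (i + 1) : ℝ)) by ring,
            s_mul_nEp]
          push_cast; ring_nf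
      _ ≤ w (i + 1) * (1 / 2 : ℝ) ^ (2 * (i + 1)) :=
          mul_le_mul_of_nonneg_left (exp_neg_nat_le_half_pow _) (w_pos _).le
      _ = q := by rw [hq4]
  -- the earlier episodes
  have hearly : ∀ j ∈ Finset.range (i + 1), term N j ≤ w j * q := by
    intro j hj
    rw [Finset.mem_range] at hj
    set t : ℕ := 2 * (i + 1) * 2 ^ (8 * i + 4) with ht
    have hjt : ((t : ℕ) : ℝ) ≤ s j * N := by
      rw [hN, ht]; push_cast
      have := s_mul_nEp_ge (show j ≤ i by omega)
      nlinarith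
    have htexp : (i + 1) ^ 2 + 2 * (i + 1) ≤ t := by
      rw [ht]
      have h1 : i + 3 ≤ 2 * 2 ^ (8 * i + 4) := by
        have := @Nat.lt_two_pow_self (8 * i + 4)
        omega
      calc (i + 1) ^ 2 + 2 * (i + 1) = (i + 1) * (i + 3) := by ring
        _ ≤ (i + 1) * (2 * 2 ^ (8 * i + 4)) := Nat.mul_le_mul_left _ h1
        _ = 2 * (i + 1) * 2 ^ (8 * i + 4) := by ring
    calc term N j ≤ w j * Real.exp (-(s j * N)) := term_le_w_mul_exp N j
      _ ≤ w j * Real.exp (-(t : ℝ)) :=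
          mul_le_mul_of_nonneg_left (Real.exp_le_exp.2 (by linarith)) (w_pos j).le
      _ ≤ w j * (1 / 2 : ℝ) ^ t := mul_le_mul_of_nonneg_left (exp_neg_nat_le_half_pow t) (w_pos j).le
      _ ≤ w j * (1 / 2 : ℝ) ^ ((i + 1) ^ 2 + 2 * (i + 1)) :=
          mul_le_mul_of_nonneg_left (pow_le_pow_of_le_one (by norm_num) (by norm_num) htexp)
            (w_pos j).le
      _ = w j * q := by rw [pow_add, hq4, hq]; rfl
  have hearly_sum : ∑ j ∈ Finset.range (i + 1), term N j ≤ 2 * q := by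
    calc ∑ j ∈ Finset.range (i + 1), term N j ≤ ∑ j ∈ Finset.range (i + 1), w j * q :=
          Finset.sum_le_sum hearly
      _ = (∑ j ∈ Finset.range (i + 1), w j) * q := by rw [Finset.sum_mul]
      _ ≤ (∑' j, w j) * q := by
          refine mul_le_mul_of_nonneg_right ?_ hq0
          exact summable_w.sum_le_tsum _ (fun j _ => (w_pos j).le)
      _ ≤ 2 * q := mul_le_mul_of_nonneg_right tsum_w_le_two hq0
  rw [hsplit, Finset.sum_range_succ]
  linarith

/-- **The loss of doubling at the episode ends**: `g(2 n_{i+1}) ≤ 4 (e/4)^{i+1} g(n_{i+1})`. [folklore] -/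
theorem g_two_nEp_le (i : ℕ) :
    g (2 * nEp (i + 1)) ≤ 4 * (Real.exp 1 / 4) ^ (i + 1) * g (nEp (i + 1)) := by
  set p : ℕ := i + 1 with hp
  have hp1 : 1 ≤ p := by omega
  set n : ℕ := nEp p with hn
  have hn1 : 1 ≤ n := one_le_nEp hp1
  have hn0 : (0 : ℝ) < n := by exact_mod_cast hn1
  have hup : level (2 * n) ≤ 4 * (w p * (1 / 4 : ℝ) ^ p) := level_two_nEp_le i
  have hlow : w p * Real.exp (-(p : ℝ)) / 2 ≤ level n := level_nEp_ge hp1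
  -- `w_p ≤ 2 e^{p} h(n)`
  have hw : w p ≤ 2 * Real.exp (p : ℝ) * level n := by
    have hE : Real.exp (-(p : ℝ)) * Real.exp (p : ℝ) = 1 := by
      rw [← Real.exp_add]; simp
    have := mul_le_mul_of_nonneg_right hlow (Real.exp_pos (p : ℝ)).le
    nlinarith [w_pos p]
  have hlev2 : level (2 * n) ≤ 8 * ((1 / 4 : ℝ) ^ p * Real.exp (p : ℝ)) * level n := by
    calc level (2 * n) ≤ 4 * (w p * (1 / 4 : ℝ) ^ p) := hup
      _ ≤ 4 * ((2 * Real.exp (p : ℝ) * level n) * (1 / 4 : ℝ) ^ p) := by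
          have : (0 : ℝ) ≤ (1 / 4 : ℝ) ^ p := by positivity
          nlinarith
      _ = 8 * ((1 / 4 : ℝ) ^ p * Real.exp (p : ℝ)) * level n := by ring
  have hpow : (1 / 4 : ℝ) ^ p * Real.exp (p : ℝ) = (Real.exp 1 / 4) ^ p := by
    rw [show (p : ℝ) = p * 1 by ring, Real.exp_nat_mul]
    simp only [div_pow, one_pow]
    ring
  rw [g_of_pos (by omega : 1 ≤ 2 * n), g_of_pos hn1]
  push_cast
  rw [hpow] at hlev2
  have hZ := Z_pos
  have hr : 0 ≤ (Real.exp 1 / 4) ^ p := by positivity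
  rw [div_le_iff₀ (by positivity)]
  calc level (2 * n) ≤ 8 * (Real.exp 1 / 4) ^ p * level n := hlev2
    _ = 4 * (Real.exp 1 / 4) ^ p * (level n / (n * Z)) * (2 * n * Z) := by
        field_simp
        ring

/-- **Doubling fails for the witness**: for every `κ > 0` some `n = n_p` has `g(2n) < κ g(n)`
(`4(e/4)^p → 0`). [folklore] -/
theorem not_axisDoubling_g : ¬ AxisDoubling g := by
  rintro ⟨κ, hκ, h⟩
  have he4 : Real.exp 1 / 4 < 1 := by
    have := Real.exp_one_lt_d9
    rw [div_lt_one (by norm_num)]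
    linarith
  have he0 : 0 < Real.exp 1 / 4 := by positivity
  obtain ⟨m, hm⟩ := exists_pow_lt_of_lt_one (show 0 < κ / 4 by positivity) he4
  have hp : (Real.exp 1 / 4) ^ (m + 1) ≤ (Real.exp 1 / 4) ^ m :=
    pow_le_pow_of_le_one he0.le he4.le (Nat.le_succ m)
  have hn1 : 1 ≤ nEp (m + 1) := one_le_nEp (by omega)
  have h1 := h (nEp (m + 1)) hn1
  have h2 := g_two_nEp_le m
  have hg := g_pos (nEp (m + 1))
  have : 4 * (Real.exp 1 / 4) ^ (m + 1) < κ := by linarith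
  nlinarith

/-! ## §4 The barrier -/

/-- **The witness satisfies every axis-profile fact** (with `C = 1`, `c = 1/96`, `K = 3`, `c₁ = 1/96²`).
[folklore] -/
theorem axisProfileFacts_g : AxisProfileFacts g where
  zero := g_zero
  pos := g_pos
  antitone := antitone_g
  ratio_mono := ratio_mono_of_hasAxisSpectralRepresentation g_pos hasAxisSpectralRepresentation_g
  upper := ⟨1, upper_g⟩
  lower := by
    refine ⟨1 / 96, by norm_num, fun n hn => (lower_threeHalves_g n hn).trans ?_⟩
    have hn1 : (1 : ℝ) ≤ n := by exact_mod_cast hn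
    have hsq : Real.sqrt n ≤ n := by
      rw [Real.sqrt_le_left (by linarith)]
      nlinarith
    have := (g_pos n).le
    have : 0 ≤ (n : ℝ) * g n := by positivity
    nlinarith
  sliding := ⟨3, sliding_of_level_antitone (fun n => (g_pos n).le) level_antitone_g⟩
  dcp := ⟨(1 / 96) ^ 2, by norm_num,
    dcp_of_lower_threeHalves (fun n => (g_pos n).le) (by norm_num) lower_threeHalves_g⟩

end AxisProfileNoDoubling

open AxisProfileNoDoubling in
/-- **Barrier (existential form).** There is an axis profile with every listed fact about the critical
two-point function along an axis — normalisation, positivity, MMS monotonicity, RP log-convexity and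
indeed the full Källén–Lehmann representation by a probability measure on `[0,3]`, the level envelope,
the DCP-fat lower envelope `n^{-3/2}/96` at EVERY scale (hence Simon–Lieb's `n^{-2}` and the DCP profile
bound), the sliding-scale bound in the strong form "`n g(n)` non-increasing" — for which all-scale
doubling FAILS. [cite: AizenmanDuminilCopinAnnals2021, arXiv:1912.07973 Remark 5.10 and §5.6 (the all-scale statement is open; this is why it is not a consequence of §5's axis estimates)] -/
theorem exists_axisProfileFacts_not_axisDoubling :
    ∃ g : ℕ → ℝ, AxisProfileFacts g ∧ HasAxisSpectralRepresentation g ∧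
      (∀ n : ℕ, 1 ≤ n → ((n : ℝ) + 1) * g (n + 1) ≤ n * g n) ∧
      (∀ n : ℕ, 1 ≤ n → (1 / 96 : ℝ) ≤ n * Real.sqrt n * g n) ∧ ¬ AxisDoubling g :=
  ⟨g, axisProfileFacts_g, hasAxisSpectralRepresentation_g, level_antitone_g, lower_threeHalves_g,
    not_axisDoubling_g⟩

/-- **Barrier (technique-class form): the master statement "the axis-profile facts (with the spectral
representation) imply all-scale doubling" is FALSE.** Consequently no proof of item `TwoPointDoubling`
(stmt-CriticalPhenomena-6150) — nor, through the funnel, of `OrbitPrecompact`, `UniformRegularity`,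
`PointwiseLimit`, `ZoomMonotone` or the existence crux `ExistsScaleCovariantLimit` — can factor through
these facts alone; an input seeing the finite-range Gibbs / random-current structure is necessary.
[cite: AizenmanDuminilCopinAnnals2021, arXiv:1912.07973 Remark 5.10] -/
theorem not_forall_axisProfileDoublingFor : ¬ ∀ g : ℕ → ℝ, AxisProfileDoublingFor g := fun h =>
  AxisProfileNoDoubling.not_axisDoubling_g
    (h _ AxisProfileNoDoubling.axisProfileFacts_g AxisProfileNoDoubling.hasAxisSpectralRepresentation_g)

end Literature.Barriers.CriticalPhenomena

end
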